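import Literature.IUT.LogVolume.Corollary22Legendre
import HarnessLib

/-!
# The field of the Θ-data at a point of the `λ`-line: "`F ⊆ F_tpd(√−1, √λ, √(λ−1), E_λ[3·5])`"

Mochizuki, *Inter-universal Teichmüller theory IV*, RIMS manuscript (Apr. 2020 = PRIMS **57** (2021)), Thm. 1.10, p. 22:
"Moreover, we assume that the `(3·5)`-torsion points of `E_F` are defined over `F`, and that
`F = F_mod(√−1, E_{F_mod}[2·3·5]) = F_tpd(√−1, E_{F_tpd}[3·5])` — i.e., that `F` is obtained from `F_tpd` by adjoining
`√−1`, together with the fields of definition of the `(3·5)`-torsion points of a model `E_{F_tpd}` of the elliptic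
curve `E_F ×_F F̄` over `F_tpd` determined by the Legendre form of the Weierstrass equation"; Cor. 2.2 (ii), p. 42:
"`F := F_tpd(√−1, E_{F_tpd}[3·5])`".

This file holds, as ONE swappable predicate on a number field `F ⊇ F_tpd = P.F` (separate from the datum file
`GenuineLogThetaPoint.lean` that consumes it), the clause PINNING the field of the Θ-volume datum at a point `P = (F_tpd,
λ)`:

* `Cor22.subThetaFieldGenerators P F ⊆ F` — the elements of `F` whose square is `−1`, `λ` or `λ − 1`, together with
  the coordinates of the `F`-rational `15`-torsion points of the Legendre curve `E_λ : y² = x(x−1)(x−λ)` over `F`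
  (abc-iut-S-d2's `Cor22.torsionCoords P F`, `Cor22.thetaCurve P F`);
* **`Cor22.IsSubThetaField P F`** — `F` is generated over `F_tpd` by such elements: "`F_tpd ⊆ F ⊆ F‡(P) :=
  F_tpd(√−1, √λ, √(λ−1), E_λ[3·5])`" stated intrinsically (every generator has its `F_tpd`-conjugates in `F‡(P)`, so
  `F` embeds into `F‡(P)` over `F_tpd`; no degree constant and no concrete model type enter).

Why this shape (route `IUTThetaPilot`, crux `ThetaPartII`, abc-iut-plan rulings 2026-08-26T01:02:38Z / 02:33:05Z = the
cell's MODEL READING v3 "`E_F :=` the Legendre curve, `F := F‡(P)`", repairing the non-Galois-over-`F_mod` gap of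
print's `F_E = F_tpd(√−1, E_λ[15])` (route finding F-L5t7-1) by adjoining the twist roots `√λ`, `√(λ−1)` (abc-iut-c312-8,
anharmonic twist identities); the earlier reading via an `F_mod`-model `W = ofJ j(λ)` was withdrawn as a cell erratum,
F-c312-8-g3-1): the layer-2 child (ii′) of the crux bounds the hull volumes of EVERY datum by the PRINTED uniform
constant of Thm. 1.10, whose Steps (ii)–(iii) (pp. 24–26) control `log(𝔡^F)`, `log(𝔡^K)` only for fields inside this
compositum (degree over `F_tpd` dividing `2³·|GL₂(𝔽₃)|·|GL₂(𝔽₅)|`, unramified over `F_tpd` away from `2·3·5` and the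
support of the conductor of `E_λ`) — over an unconstrained `F` no such bound holds. Print's own `F_E` satisfies the
predicate (`IsSubThetaField.of_isThetaField`, from S-d2's `IsThetaField`), as does `F‡(P)` and anything between. A
further repair of the reading that needs more generators is a re-filing of THIS file only.

Definitions + trivial API; TAKES NO SIDE on anything disputed; nothing is asserted about any field.
[cite: Mochizuki2012, IUTchIV Thm. 1.10 p. 22] [cite: Mochizuki2012, IUTchIV Cor. 2.2 (ii) p. 42] (claim key, disputed).
-/

noncomputable section

namespace Literature.IUT.LogVolume

namespace Cor22

open Literature.NumberTheory.DiophantineGeometry.GenEll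

variable (P : NFPoint) (F : Type) [Field F] [NumberField F] [Algebra P.F F]

/-- **The admissible generators of the field of the Θ-data at `P = (F_tpd, λ)`** inside a field `F ⊇ F_tpd`: the
square roots of `−1`, of `λ` and of `λ − 1` present in `F`, and the coordinates of the `F`-rational `(3·5)`-torsion points
of the Legendre curve `E_λ` over `F` ("`√−1, E_{F_tpd}[3·5]`", p. 22; the twist roots `√λ, √(λ−1)` are the cell's repair
making the compositum Galois over `F_mod`). [claim: Mochizuki2012, status: disputed] -/
def subThetaFieldGenerators : Set F :=
  {x : F | x ^ 2 = -1 ∨ x ^ 2 = algebraMap P.F F P.x ∨ x ^ 2 = algebraMap P.F F P.x - 1} ∪ torsionCoords P F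

/-- **`F_tpd ⊆ F ⊆ F‡(P) = F_tpd(√−1, √λ, √(λ−1), E_λ[3·5])`, intrinsically**: `F` is generated over `F_tpd` by admissible
generators (Thm. 1.10 p. 22 "`F` is obtained from `F_tpd` by adjoining `√−1`, together with the fields of definition of
the `(3·5)`-torsion points of [the Legendre model]", in the cell's model reading v3). A PREDICATE (one-field structure, so that a
further repair of the reading adds clauses without renaming) used as the pinning field of `Cor22.ThetaVolumeDatumAt`;
nothing is asserted. [claim: Mochizuki2012, status: disputed] -/
structure IsSubThetaField : Prop where
  /-- `F = F_tpd(admissible generators)` -/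
  adjoin_eq_top : IntermediateField.adjoin P.F (subThetaFieldGenerators P F) = ⊤

variable {P F}

/-- Unfolding. [claim: Mochizuki2012, status: disputed] -/
theorem isSubThetaField_iff :
    IsSubThetaField P F ↔ IntermediateField.adjoin P.F (subThetaFieldGenerators P F) = ⊤ :=
  ⟨fun h => h.adjoin_eq_top, fun h => ⟨h⟩⟩

/-- A square root of `−1` is an admissible generator. [claim: Mochizuki2012, status: disputed] -/
theorem mem_subThetaFieldGenerators_of_sq_eq_neg_one {x : F} (hx : x ^ 2 = -1) :
    x ∈ subThetaFieldGenerators P F :=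
  Or.inl (Or.inl hx)

/-- A square root of `λ` is an admissible generator. [claim: Mochizuki2012, status: disputed] -/
theorem mem_subThetaFieldGenerators_of_sq_eq (hx : ∃ x : F, x ^ 2 = algebraMap P.F F P.x) :
    ∃ x ∈ subThetaFieldGenerators P F, x ^ 2 = algebraMap P.F F P.x := by
  obtain ⟨x, hx⟩ := hx
  exact ⟨x, Or.inl (Or.inr (Or.inl hx)), hx⟩

/-- A square root of `λ − 1` is an admissible generator. [claim: Mochizuki2012, status: disputed] -/
theorem mem_subThetaFieldGenerators_of_sq_eq_sub_one {x : F} (hx : x ^ 2 = algebraMap P.F F P.x - 1) :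
    x ∈ subThetaFieldGenerators P F :=
  Or.inl (Or.inr (Or.inr hx))

/-- Coordinates of `F`-rational `15`-torsion points of `E_λ` are admissible generators.
[claim: Mochizuki2012, status: disputed] -/
theorem torsionCoords_subset_subThetaFieldGenerators : torsionCoords P F ⊆ subThetaFieldGenerators P F :=
  Set.subset_union_right

/-- **Criterion**: if `F` is generated over `F_tpd` by ANY subset of the admissible generators, then `IsSubThetaField P F`
(the constructor of `F‡(P)`, or of print's `F_E` where it is used, discharges the pinning clause this way).
[claim: Mochizuki2012, status: disputed] -/
theorem IsSubThetaField.of_adjoin_eq_top {S : Set F} (hS : S ⊆ subThetaFieldGenerators P F)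
    (h : IntermediateField.adjoin P.F S = ⊤) : IsSubThetaField P F :=
  ⟨top_le_iff.mp (h ▸ IntermediateField.adjoin.mono P.F S _ hS)⟩

/-- **Print's `F_E = F_tpd(√−1, E_λ[3·5])` is admissible**: abc-iut-S-d2's `IsThetaField P F` (its clause
`adjoin_eq_top : F_tpd(±√−1, torsion coordinates) = F`) implies `IsSubThetaField P F`. So the predicate does not commit
to the cell's repair: it only bounds `F` from above by the compositum. [cite: Mochizuki2012, IUTchIV Cor. 2.2 (ii) p. 42] -/
theorem IsSubThetaField.of_isThetaField (h : IsThetaField P F) : IsSubThetaField P F :=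
  IsSubThetaField.of_adjoin_eq_top
    (Set.union_subset_union_left _ (fun _ hx => Or.inl hx)) h.adjoin_eq_top

/-- **`F ↪ L` over `F_tpd`** for any extension `L ⊇ F_tpd` in which the minimal polynomial over `F_tpd` of every
admissible generator of `F` splits — in particular `L := F‡(P)` (a normal extension of `F_tpd` containing square roots of
`−1, λ, λ−1` and all `15`-torsion coordinates of `E_λ`): the intrinsic clause `IsSubThetaField P F` really says
`F_tpd ⊆ F ⊆ F‡(P)` up to `F_tpd`-isomorphism (Mathlib's `IntermediateField.nonempty_algHom_of_adjoin_splits`).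
[cite: Mochizuki2012, IUTchIV Thm. 1.10 p. 22] -/
theorem IsSubThetaField.nonempty_algHom (h : IsSubThetaField P F) {L : Type*} [Field L] [Algebra P.F L]
    (hL : ∀ x ∈ subThetaFieldGenerators P F,
      IsIntegral P.F x ∧ ((minpoly P.F x).map (algebraMap P.F L)).Splits) :
    Nonempty (F →ₐ[P.F] L) :=
  IntermediateField.nonempty_algHom_of_adjoin_splits hL h.adjoin_eq_top

/-- Hence **`[F : F_tpd] ≤ [L : F_tpd]`** for any such finite `L ⊇ F_tpd` (e.g. `L = F‡(P)`: the degree bound of [IUTchIV]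
Thm. 1.10 Step (ii) for the datum's field follows from the one for `F‡(P)`). [cite: Mochizuki2012, IUTchIV Thm. 1.10 proof Step (ii) p. 24] -/
theorem IsSubThetaField.finrank_le (h : IsSubThetaField P F) {L : Type*} [Field L] [Algebra P.F L]
    [FiniteDimensional P.F L]
    (hL : ∀ x ∈ subThetaFieldGenerators P F,
      IsIntegral P.F x ∧ ((minpoly P.F x).map (algebraMap P.F L)).Splits) :
    Module.finrank P.F F ≤ Module.finrank P.F L := by
  obtain ⟨φ⟩ := h.nonempty_algHom hL
  exact LinearMap.finrank_le_finrank_of_injective (f := φ.toLinearMap) φ.injective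

end Cor22

end Literature.IUT.LogVolume

end
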